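import Literature.AnabelianGeometry.AbsoluteAnabelian.AbsTopIII.FrobeniusPictureMLFShiftGlue
import Literature.AnabelianGeometry.AbsoluteAnabelian.AbsTopIII.FrobeniusPictureMLFLogGlueCrossAdapter
import Literature.AnabelianGeometry.AbsoluteAnabelian.AbsTopIII.FrobeniusPictureMLFLogGlueCrossInduction
import Literature.AnabelianGeometry.AbsoluteAnabelian.AbsTopIII.FrobeniusPictureMLFLogGlueCrossGenerators

/-!
# [AbsTopIII] Corollary 3.6 (v), third sentence `ShiftCompatStmt` — REDUCED TO THE CROSS-TERM IDENTITY
# (the same single hypothesis as the cores clause of (iii)); the compatibility itself is unconditional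

S. Mochizuki, *Topics in Absolute Anabelian Geometry III*, Cor. 3.6 (v) p. 80 of the kurims manuscript
(`paper:url-5493eb38cbb7`; bib key `MochizukiAbsTopIII2015`): "the self-equivalences in these nexus-classes are
compatible with the families of homotopies that constitute the cores and observable of (i), (iii)" — typed
`LogFrobeniusData.ShiftCompatStmt` (`FrobeniusPictureMLFCompatibility.lean`, abc-iut-L4-t5; reduction
`shiftCompatStmt_of`, `FrobeniusPictureMLFCompatibilityTransport.lean`).  Seat abc-iut-w6-d023, row «Cor36-SHIFT»
(§(v) of the abc-iut-L4-t5 blueprint `HOME/staging/L4/L4-t5/DISCHARGE-PLAN-Cor36-compat.md`), assembly of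
`FrobeniusPictureMLFShiftCores.lean` (cores family `K₀` invariant), `FrobeniusPictureMLFShiftLog.lean` (the
`𝔖_log` family invariant), `FrobeniusPictureMLFShiftGlue.lean` (glued boundary set and glued homotopies
invariant) with the MASTER FAMILY `glueFamily H₃ hgen hcross` of abc-iut-w5-d053 / abc-iut-L4-t5
(`FrobeniusPictureMLFLogGlueFamily.lean`):

* `compatibleWith_shiftEquiv_glueFamily` — for EVERY `Δ`, every `𝔖_log` family `H₃`, every `m : ℤ` and WHATEVER
  witness `hcross` of the cross-term identity the master family is built with, the nexus self-equivalence
  `Φ_m = shiftEquiv m` (translation of the first row, identity functors) is compatible with the master family in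
  the sense of Def. 3.5 (v) (`OneMorphism.CompatibleWith`: `Φ_Γ⃗` induces a bijection of the boundary sets, the
  homotopies commute with the `Φ_{[γ]}`) — NO hypothesis beyond the data of the family;
* `realisesCoresAndLogObs_glueFamily` — the master family realises the cores of (i) and `𝔖_log` (the content of
  abc-iut-w5-d053's `logObsCompatCoresStmt_of_glueCross`, exposed for the named family);
* `shiftCompatStmt_of_glueCross` — **Cor. 3.6 (v), third sentence, from the single hypothesis `hcross`** (the
  cross-term gluing identity = `IotaOverGaloisStmt`, F-0360, on the type-(1)/(2) generators extended over
  `Sat(LogGen)`; abc-iut-L4-t5's «Cor36-CROSS» line discharges it), and `shiftCompatStmt_of_imageCross` — the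
  same from its image form (adapter `glueCross_of_mapPath`, `FrobeniusPictureMLFLogGlueCrossAdapter.lean`);
* `logObsCompatCores_and_shiftCompat_of_glueCross` — (iii) cores clause and (v) sentence 3 together, from the one
  hypothesis, with ONE master family;
* `shiftCompatStmt_of_iotaOverGalois` — Cor. 3.6 (v), third sentence, for every `𝔖_log` family, from the NAMED FACT
  `IotaOverGaloisStmt` (F-0360) alone, through abc-iut-L4-t5 / abc-iut-w5-d053's «Cor36-CROSS» chain
  (`generatorCross_of_iotaOverGalois` → `imageCross_of_generators` → `glueCross_of_mapPath`).

HONEST SCOPE: `hcross` is the ONLY hypothesis of the two `…_of_glueCross` theorems and it is the SAME hypothesis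
as for the (iii) cores clause; the Def. 3.5 (v) compatibility of `Φ_m` with the master family is proved
outright.  Print, proof of (v) p. 82: "The remainder of assertion (v) follows immediately from the definitions."
Pure category theory over the typed data; nothing here bears on [IUTchIII] Cor. 3.12; no side is taken on
inter-universal Teichmüller theory.
-/

namespace Literature.AnabelianGeometry.AbsoluteAnabelian

open _root_.CategoryTheory _root_.Quiver

universe u

namespace LogFrobeniusData

open DiagramOfCategories

variable {Δ : LogFrobeniusData.{u}}

/-- **The nexus self-equivalences are compatible with the master family (Def. 3.5 (v)) — unconditionally in
the data of the family**: for every `𝔖_log` family `H₃`, every witness `hcross` of the cross-term identity and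
every `m : ℤ`, `Φ_m = shiftEquiv m` is compatible with `glueFamily H₃ _ hcross` (boundary sets:
`glueE_shift_iff`; homotopies: `glueη_shift_heq`; assembled by `OneMorphism.compatibleWithOfInvariant`).
[cite: MochizukiAbsTopIII2015, Corollary 3.6 (v) p.80] -/
theorem compatibleWith_shiftEquiv_glueFamily {H₃ : Δ.sub3.HomotopyFamily} (hH₃ : Δ.IsLogObservableFamily H₃)
    (hcross : ∀ ⦃a c d : LFVertex⦄ ⦃P Q : Path a LFVertex.third⦄ (h : Δ.GlueE P Q) (r₁ : Path c a)
      (r₂ : Path LFVertex.third d), coreVertices d →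
      Δ.glueη H₃ hH₃.1 (Δ.isSaturated_glueE.precomp (Δ.isSaturated_glueE.postcomp h r₂) r₁) =
        eqToHom (by rw [pathFunctor_comp, pathFunctor_comp]) ≫
          Functor.whiskerLeft (Δ.diagram.pathFunctor r₁)
            (Functor.whiskerRight (Δ.glueη H₃ hH₃.1 h) (Δ.diagram.pathFunctor r₂)) ≫
          eqToHom (by rw [pathFunctor_comp, pathFunctor_comp]))
    (m : ℤ) :
    Nonempty ((Δ.shiftEquiv m).hom.CompatibleWith (Δ.glueFamily H₃ hH₃.1 hcross)
      (Δ.glueFamily H₃ hH₃.1 hcross)) :=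
  OneMorphism.nonempty_compatibleWith_of_invariant (Δ.shiftMor m) (Δ.comapAlong_shift m)
    (Δ.shiftApp_heq_id m) (Δ.shiftMor_iso_app m) (fun _ _ p' => exists_shift_mapPath_eq m p')
    (Δ.glueFamily H₃ hH₃.1 hcross) (Δ.glueFamily H₃ hH₃.1 hcross) (fun _ _ P Q => Δ.glueE_shift_iff m P Q)
    (fun _ _ _ _ h => glueη_shift_heq hH₃ m h _)

/-- **The master family realises the cores of (i) and the observable `𝔖_log` of (iii)** (Def. 3.5 (ii)
compatibility along the embeddings of the presentations): the `𝔖_log` family `H₃` itself along `𝒟_{≤3} ↪ 𝒟`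
(`compatibleAlong_embLog_glueFamily`) and, for `n = 4, 5, 6`, the pulled-back pairs into the core vertex (a core
structure, all pairs into the core vertex being glued pairs through it) — the content of abc-iut-w5-d053's
`logObsCompatCoresStmt_of_glueCross`, stated for the named family. [cite: MochizukiAbsTopIII2015, Corollary 3.6 (iii) p.80] -/
theorem realisesCoresAndLogObs_glueFamily {H₃ : Δ.sub3.HomotopyFamily} (hH₃ : Δ.IsLogObservableFamily H₃)
    (hcross : ∀ ⦃a c d : LFVertex⦄ ⦃P Q : Path a LFVertex.third⦄ (h : Δ.GlueE P Q) (r₁ : Path c a)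
      (r₂ : Path LFVertex.third d), coreVertices d →
      Δ.glueη H₃ hH₃.1 (Δ.isSaturated_glueE.precomp (Δ.isSaturated_glueE.postcomp h r₂) r₁) =
        eqToHom (by rw [pathFunctor_comp, pathFunctor_comp]) ≫
          Functor.whiskerLeft (Δ.diagram.pathFunctor r₁)
            (Functor.whiskerRight (Δ.glueη H₃ hH₃.1 h) (Δ.diagram.pathFunctor r₂)) ≫
          eqToHom (by rw [pathFunctor_comp, pathFunctor_comp])) :
    Δ.RealisesCoresAndLogObs (Δ.glueFamily H₃ hH₃.1 hcross) := by
  let K := Δ.glueFamily H₃ hH₃.1 hcross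
  have h₄ : (Δ.coreObs4 (Δ.coreFamily4Of K) (fun _ _ _ _ h => h.1)).IsCore :=
    ⟨fun _ p q => ⟨rfl, (Δ.pullCore4_E_iff K p q).mpr (GlueE.univ
        (univE_of_mem coreVertices (Or.inl rfl) (embCore4.mapPath p) (embCore4.mapPath q)))⟩, reaches4⟩
  have h₅ : (Δ.coreObs5 (Δ.coreFamily5Of K) (fun _ _ _ _ h => h.1)).IsCore :=
    ⟨fun _ p q => ⟨rfl, (Δ.pullCore5_E_iff K p q).mpr (GlueE.univ
        (univE_of_mem coreVertices (Or.inr (Or.inl rfl)) (embCore5.mapPath p) (embCore5.mapPath q)))⟩,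
      reaches5⟩
  have h₆ : (Δ.coreObs6 (Δ.coreFamily6Of K) (fun _ _ _ _ h => h.1)).IsCore :=
    ⟨fun _ p q => ⟨rfl, (Δ.pullCore6_E_iff K p q).mpr (GlueE.univ
        (univE_of_mem coreVertices (Or.inr (Or.inr rfl)) (embCore6.mapPath p) (embCore6.mapPath q)))⟩,
      reaches6⟩
  exact ⟨⟨H₃, hH₃, compatibleAlong_embLog_glueFamily hH₃ hcross⟩,
    ⟨_, _, h₄, HomotopyFamily.endingAt_compatibleAlong _ _ _ (Δ.pullCore4_compatibleAlong K) _ _⟩,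
    ⟨_, _, h₅, HomotopyFamily.endingAt_compatibleAlong _ _ _ (Δ.pullCore5_compatibleAlong K) _ _⟩,
    ⟨_, _, h₆, HomotopyFamily.endingAt_compatibleAlong _ _ _ (Δ.pullCore6_compatibleAlong K) _ _⟩⟩

/-- **[AbsTopIII] Cor. 3.6 (v), third sentence — REDUCED TO THE CROSS-TERM IDENTITY.**  Given the `𝔖_log` family
`H₃` on `𝒟_{≤3}` (it exists for every `𝒟`: abc-iut-w4-d095's `observableLogStmt`) and the cross-term gluing
identity `hcross` for the glued homotopies (the SAME single hypothesis as the (iii) cores clause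
`logObsCompatCoresStmt_of_glueCross`), the `ℤ`-action of (v) by the nexus self-equivalences `Φ_m` (translation of
the first row, `shiftEquiv`) is compatible, in the sense of Def. 3.5 (v), with a family of homotopies on `𝒟`
realising the cores of (i) and the observable `𝔖_log` of (iii) — the master family.  HONEST SCOPE: `hcross` is
the ONLY hypothesis; its content is `IotaOverGaloisStmt` (F-0360; PROVED AT THE MODEL,
`TFModel.iotaOverGaloisStmt_model`) on the type-(1)/(2) generators extended over `Sat(LogGen)` — not discharged
here; the compatibility of `Φ_m` with the master family is unconditional (`compatibleWith_shiftEquiv_glueFamily`).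
[cite: MochizukiAbsTopIII2015, Corollary 3.6 (v) p.80] -/
theorem shiftCompatStmt_of_glueCross {H₃ : Δ.sub3.HomotopyFamily} (hH₃ : Δ.IsLogObservableFamily H₃)
    (hcross : ∀ ⦃a c d : LFVertex⦄ ⦃P Q : Path a LFVertex.third⦄ (h : Δ.GlueE P Q) (r₁ : Path c a)
      (r₂ : Path LFVertex.third d), coreVertices d →
      Δ.glueη H₃ hH₃.1 (Δ.isSaturated_glueE.precomp (Δ.isSaturated_glueE.postcomp h r₂) r₁) =
        eqToHom (by rw [pathFunctor_comp, pathFunctor_comp]) ≫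
          Functor.whiskerLeft (Δ.diagram.pathFunctor r₁)
            (Functor.whiskerRight (Δ.glueη H₃ hH₃.1 h) (Δ.diagram.pathFunctor r₂)) ≫
          eqToHom (by rw [pathFunctor_comp, pathFunctor_comp])) :
    Δ.ShiftCompatStmt :=
  Δ.shiftCompatStmt_of (Δ.glueFamily H₃ hH₃.1 hcross) (realisesCoresAndLogObs_glueFamily hH₃ hcross)
    (compatibleWith_shiftEquiv_glueFamily hH₃ hcross)

/-- **[AbsTopIII] Cor. 3.6 (iii) cores clause AND (v) third sentence, with ONE master family, from the single
hypothesis `hcross`.** [cite: MochizukiAbsTopIII2015, Corollary 3.6 (v) p.80] -/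
theorem logObsCompatCores_and_shiftCompat_of_glueCross {H₃ : Δ.sub3.HomotopyFamily}
    (hH₃ : Δ.IsLogObservableFamily H₃)
    (hcross : ∀ ⦃a c d : LFVertex⦄ ⦃P Q : Path a LFVertex.third⦄ (h : Δ.GlueE P Q) (r₁ : Path c a)
      (r₂ : Path LFVertex.third d), coreVertices d →
      Δ.glueη H₃ hH₃.1 (Δ.isSaturated_glueE.precomp (Δ.isSaturated_glueE.postcomp h r₂) r₁) =
        eqToHom (by rw [pathFunctor_comp, pathFunctor_comp]) ≫
          Functor.whiskerLeft (Δ.diagram.pathFunctor r₁)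
            (Functor.whiskerRight (Δ.glueη H₃ hH₃.1 h) (Δ.diagram.pathFunctor r₂)) ≫
          eqToHom (by rw [pathFunctor_comp, pathFunctor_comp])) :
    Δ.LogObsCompatCoresStmt ∧ Δ.ShiftCompatStmt :=
  ⟨logObsCompatCoresStmt_of_glueCross hH₃ hcross, shiftCompatStmt_of_glueCross hH₃ hcross⟩

/-- **Cor. 3.6 (v), third sentence, from the IMAGE FORM of the cross-term identity** (the shape abc-iut-L4-t5's
«Cor36-CROSS» line proves from `IotaOverGaloisStmt`; adapter `glueCross_of_mapPath`).
[cite: MochizukiAbsTopIII2015, Corollary 3.6 (v) p.80] -/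
theorem shiftCompatStmt_of_imageCross {H₃ : Δ.sub3.HomotopyFamily} (hH₃ : Δ.IsLogObservableFamily H₃)
    (himg : ∀ ⦃c₀ a₀ : logObsShape.{u}.Vertex⦄ (r : Path c₀ a₀) (p q : Path a₀ lvObs) (hh : H₃.E p q)
      ⦃d : LFVertex⦄ (r₂ : Path LFVertex.third d), coreVertices d →
      ∀ h' : Δ.GlueE ((embLog.mapPath r).comp ((embLog.mapPath p).comp r₂))
          ((embLog.mapPath r).comp ((embLog.mapPath q).comp r₂)),
        Δ.glueη H₃ hH₃.1 h' =
          eqToHom (by rw [pathFunctor_comp, pathFunctor_comp]) ≫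
            Functor.whiskerLeft (Δ.diagram.pathFunctor (embLog.mapPath r))
              (Functor.whiskerRight (Δ.pushLogη H₃ hh) (Δ.diagram.pathFunctor r₂)) ≫
            eqToHom (by rw [pathFunctor_comp, pathFunctor_comp])) :
    Δ.ShiftCompatStmt :=
  shiftCompatStmt_of_glueCross hH₃ (Δ.glueCross_of_mapPath H₃ hH₃.1 himg)

/-- **[AbsTopIII] Cor. 3.6 (v), third sentence, from the named fact `IotaOverGaloisStmt`** (F-0360: "`ι_×`,
`ι_{log,⋎}` lie over `ℰ`" — "the various Galois groups that appear remain undisturbed", proof of (iii) p. 81;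
PROVED AT THE MODEL, `TFModel.iotaOverGaloisStmt_model`), for every `𝔖_log` family `H₃`: the cross-term identity
is supplied by the «Cor36-CROSS» chain of abc-iut-L4-t5 / abc-iut-w5-d053 (generators from `IotaOverGaloisStmt`,
`generatorCross_of_iotaOverGalois`; extension over `Sat(LogGen)`, `imageCross_of_generators`; adapter
`glueCross_of_mapPath`).  HONEST SCOPE: conditional on the named fact only.
[cite: MochizukiAbsTopIII2015, Corollary 3.6 (v) p.80] -/
theorem shiftCompatStmt_of_iotaOverGalois {H₃ : Δ.sub3.HomotopyFamily} (hH₃ : Δ.IsLogObservableFamily H₃)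
    (hι : Δ.IotaOverGaloisStmt) : Δ.ShiftCompatStmt :=
  shiftCompatStmt_of_imageCross hH₃ fun _ _ r p q hh _ r₂ hd h' =>
    imageCross_of_generators hH₃ (generatorCross_of_iotaOverGalois hH₃ hι) ((hH₃.1 p q).mp hh) r hh r₂ hd h'

/-- **[AbsTopIII] Cor. 3.6 (iii) cores clause AND (v) third sentence from the named fact `IotaOverGaloisStmt`**,
for every `𝔖_log` family, with ONE master family (the (iii) half is abc-iut-w5-d053 / abc-iut-L4-t5's chain
composed by name). [cite: MochizukiAbsTopIII2015, Corollary 3.6 (v) p.80] -/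
theorem logObsCompatCores_and_shiftCompat_of_iotaOverGalois {H₃ : Δ.sub3.HomotopyFamily}
    (hH₃ : Δ.IsLogObservableFamily H₃) (hι : Δ.IotaOverGaloisStmt) :
    Δ.LogObsCompatCoresStmt ∧ Δ.ShiftCompatStmt :=
  logObsCompatCores_and_shiftCompat_of_glueCross hH₃ (Δ.glueCross_of_mapPath H₃ hH₃.1 fun _ _ r p q hh _ r₂ hd h' =>
    imageCross_of_generators hH₃ (generatorCross_of_iotaOverGalois hH₃ hι) ((hH₃.1 p q).mp hh) r hh r₂ hd h')

end LogFrobeniusData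

end Literature.AnabelianGeometry.AbsoluteAnabelian
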